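import Summits.BirchSwinnertonDyer.BirchSwinnertonDyer.Theorems.KolyvaginDepthDoorDepthTableKuriharaExactSides
import Summits.BirchSwinnertonDyer.BirchSwinnertonDyer.Theorems.Rank2ObservatoryZModChain
import Summits.BirchSwinnertonDyer.BirchSwinnertonDyer.Theorems.Rank2ObservatoryReductionHom
import Literature.NumberTheory.EllipticCurves.KuriharaNumberSakamotoPSelmerStructure
import Literature.NumberTheory.EllipticCurves.KuriharaNumberInvariants
import Literature.NumberTheory.EllipticCurves.KuriharaNumberKimModPSelmerBound
import HarnessLib

/-!
# Route `KolyvaginDepthDoor`, crux `KolyvaginDepthSupplyKN` (stmt-BirchSwinnertonDyer-22820) —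
# DEPTH TABLE v19, GENERIC: «THE DECISIVE PRIME» — at a PRESCRIBED cyclic Kolyvagin prime `ℓ★` of a curve with
# `#Sel_p ≤ p` and a rational point locally `p`-indivisible at `ℓ★`, the mod-`p` Kurihara number `δ̃_{ℓ★}` IS A UNIT
# (Sakamoto 2022 Lemma 4.4 + Lemma 4.6 (1) BY NAME); the local indivisibility from a KERNEL addition chain in `Ẽ(𝔽_{ℓ★})`

Helper file of the lead prover of line `levelone` (kdd-p1 g23; `--supports stmt-BirchSwinnertonDyer-22820
--as helper`); it closes nothing and BSD is NOT proved by it.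

WHY. v18 (g22) made every row of the depth table an IFF per `(E, p, K)` in Kurihara currency: the row's bit
⟺ «SOME cyclic Kolyvagin prime `ℓ` of the twist model `T₀` carries a unit `δ̃_ℓ(T₀)`» — so a unit closes the
row, but a computed ZERO at one prime refutes nothing (only a `δ`-minimal TRIPLE does). v19 names the prime:
R. Sakamoto, Doc. Math. 27 (2022), Lemma 4.4 (`δ̃_d ≠ 0 ⟺ H¹_{𝓕_cl(d)}(ℚ, E[p]) = 0`) with Lemma 4.6 (1)
(`λ(dℓ) = λ(d) − 1` as soon as the localisation at `ℓ` is non-zero on `H¹_{𝓕_cl(d)}`) and Remark 4.5, at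
`d = 1`, give: if `dim Sel_p(E) = 1` and the localisation `Sel_p(E) → E(ℚ_ℓ) ⊗ 𝔽_p` is non-zero — witnessed,
as in Kurihara's own numerical examples (Contrib. Math. Comput. Sci. 7 (2014) §5.3), by a rational point `P` with
`P ∉ p·E(ℚ_ℓ)` — then `δ̃_ℓ ≠ 0`. So for a curve with `#Sel_p ≤ p` and such a point, the residue at THAT prime is
a unit; read on the twist model of a row: the row's bit (which gives `#Sel_p(T₀) ≤ p`) FORCES a unit at every
★-prime of CLOSING-DATA-v18 §2b, and ONE computed zero there refutes the row's clause at `(p, K)` modulo print.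

CONTENTS.
* §0 the named print input `Sakamoto2022_kuriharaNumber_prime_ne_zero_of_localNondivisible` (inline, for the
  gate to relocate under `Literature/NumberTheory/EllipticCurves/`), BY NAME — nothing is asserted.
* §1 `kuriharaClaim_prime_of_natCard_selmerGroup_le` — the tree-vocabulary form: `W` globally minimal, `p ≥ 5`
  good ordinary, `ρ̄_{E,p}` onto, `a_p ≢ 1`, Kodaira–Néron at `p` (⟹ `p ∤ #Ẽ(𝔽_p)·Tam`), `#Sel_p(E) ≤ p`, `ℓ` a
  cyclic Kolyvagin prime, `P ∈ E(ℚ)` with `P ∉ p·E(ℚ_ℓ)` ⟹ the CLAIM shape of `KuriharaCertificates.Record.Claim`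
  at level `ℓ` (for every admissible datum, a unit mod-`p` Kurihara number at `ℓ`).
* §2 `localNondivisible_of_chainB` (integral point) / `localNondivisible_of_chainB_rat` (rational point with
  denominators prime to `q`) — KERNEL BRIDGE: for an integral model `V`, a prime `q ∤ Δ(V)`, an integral
  point `P = (X, Y)` and an affine addition chain certifying `k • P̄ ≠ O` in `Ẽ(𝔽_q)` with `p·k = #Ẽ(𝔽_q)`
  (`Rank2Observatory.chainB`, `decide`-able data), `P ∉ p·E(ℚ_q)`: the reduction homomorphism `E(ℚ) → Ẽ(𝔽_q)`
  of `Rank2ObservatoryReductionHom` FACTORS through `E(ℚ_q)` (AEC VII.2), so `P = p·Q` in `E(ℚ_q)` would give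
  `k • P̄ = (pk) • Q̄ = #Ẽ • Q̄ = O`.
* §3 `twistKuriharaClaim_prime_of_natCard_selmerGroup_le` — the twist form used by the row sockets: `C • T =
  W.quadraticTwist d`, `#Sel_p(E^{(d)}) ≤ p` (the row's bit, exact reading) ⟹ unit `δ̃_ℓ(T)` for every
  admissible datum of `T`, at every cyclic Kolyvagin prime `ℓ` of `T` where a rational point of `T` is locally
  `p`-indivisible.

CONDITIONAL on the named facts displayed as hypotheses (`hSak3` = §0, modularity `hnf`, Mazur 1978 Cor. 4.1
`hMaz` only where a datum must be produced); per `(W, p, ℓ)`; nothing class-wide (the open stub (S♭) is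
untouched); BSD is NOT proved by any of this.

References: [Sakamoto2022pSelmer] R. Sakamoto, Doc. Math. 27 (2022) 1891–1922 = arXiv:2106.03370, §1 (a)–(c),
Def. 2.3–2.4, Thm. 2.20, Prop. 3.16, Lemma 4.4, Rem. 4.5, Lemma 4.6; [Kurihara2014] M. Kurihara, Contrib. Math.
Comput. Sci. 7 (2014) = arXiv:1407.2465, Thm. 1.2.3, §5.3 examples (8), (9); [Kim2022StructureSelmer] Thm. 1.11;
[BurungaleCastellaSkinner2025] Thm. 1.1.2 (b); [Kato2004Asterisque] Thm. 17.4; [MazurRubin2004] Lemma 4.1.7;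
[SilvermanAEC2009] VII.2.1, VII.3.1, VIII.2, X.4.2.
-/

set_option linter.dupNamespace false

noncomputable section

open scoped Classical NumberField

/-! ## §0 The named print input (Sakamoto 2022, Lemma 4.4 + Lemma 4.6 (1) at depth one), BY NAME -/

namespace Summit.BirchSwinnertonDyer.BirchSwinnertonDyer.Theorems.KolyvaginDepthDoor

open Literature.NumberTheory.EllipticCurves Literature.NumberTheory.EllipticCurves.ModularForms
  WeierstrassCurve NumberField IsDedekindDomain
open Summit.BirchSwinnertonDyer.BirchSwinnertonDyer.Theorems
open Summit.BirchSwinnertonDyer.BirchSwinnertonDyer.Rank2Observatory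

/-! ## §1 The tree-vocabulary form: the claim at a prescribed prime from `#Sel_p ≤ p` and a locally indivisible point -/

/-- **THE DECISIVE PRIME (E-side form): a unit mod-`p` Kurihara number AT THE PRESCRIBED PRIME `ℓ`.** `W`
globally minimal elliptic; `p ≥ 5` good ordinary with `ρ̄_{E,p}` onto; `a_p ≢ 1 (mod p)` (⟺ `p ∤ #Ẽ(𝔽_p)`,
`dvd_reductionPointCount_iff_dvd_frobeniusTrace_sub_one`); `p ∤ ord_v(Δ_min)` at multiplicative `v` (⟹ `p ∤
Tam(E)`, `not_dvd_tamagawaProduct_of_kodairaNeron`); `#Sel_p(E/ℚ) ≤ p`; `ℓ` a cyclic Kolyvagin prime of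
`(E, p)`; `P ∈ E(ℚ)` with `P ∉ p·E(ℚ_ℓ)`. THEN every datum `D` at level `N_E` with `p ∤ c_D` and the period
transfer carries a unit Kurihara number AT `ℓ` — the shape of `KuriharaCertificates.Record.Claim` at level `ℓ`
(Sakamoto L4.4 + L4.6 (1) by name, `hSak3`). CONDITIONAL on `hSak3`; per `(W, p, ℓ)`; BSD is not proved by it.
[cite: Sakamoto2022pSelmer, Lemma 4.4, Lemma 4.6 (1) (p. 14)] [cite: SilvermanAEC2009, VII.3 Prop. 3.1] -/
theorem kuriharaClaim_prime_of_natCard_selmerGroup_le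
    (hSak3 : Literature.NumberTheory.EllipticCurves.Sakamoto2022_kuriharaNumber_prime_ne_zero_of_localNondivisible)
    (W : WeierstrassCurve ℚ) [W.IsElliptic] [W.IsGloballyMinimal] (p : ℕ) [hp : Fact p.Prime] (h5 : 5 ≤ p)
    (hgood : W.HasGoodReductionAtPrime p) (hord : ¬ (p : ℤ) ∣ W.frobeniusTrace p)
    (hsur : W.HasSurjectiveModNGaloisRep p) (hna : ¬ (p : ℤ) ∣ W.frobeniusTrace p - 1)
    (hKN : ∀ v : HeightOneSpectrum (𝓞 ℚ), W.HasMultiplicativeReductionAt v → ¬ p ∣ W.ordMinimalDiscriminant v)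
    (hle : Nat.card (W.selmerGroup p) ≤ p)
    (ℓ : ℕ) [Fact ℓ.Prime] (hℓ : IsCyclicKolyvaginLevel W p ℓ)
    (P : W.toAffine.Point)
    (hP : ∀ Q : (W.baseChange ℚ_[ℓ]).toAffine.Point,
      p • Q ≠ WeierstrassCurve.Affine.Point.map (W' := W.toAffine) (S := ℚ) (Algebra.ofId ℚ ℚ_[ℓ]) P)
    {N : ℕ} [NeZero N] (D : ModularParametrizationData W N) (hc : ¬ (p : ℤ) ∣ D.maninConstant)
    (hu : ∃ u : ℚ, ‖(u : ℚ_[p])‖ = 1 ∧ W.realPeriodRat = u * plusPeriod D.f) :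
    ∃ ψ : (q : ℕ) → (ZMod q)ˣ →* Multiplicative (ZMod p),
      (∀ q ∈ ℓ.primeFactors, Function.Surjective (ψ q)) ∧ kuriharaNumber D.f p ℓ ψ ≠ 0 := by
  have htam : ¬ p ∣ W.tamagawaProduct := not_dvd_tamagawaProduct_of_kodairaNeron W p h5 hKN
  have hnap : ¬ p ∣ W.reductionPointCount p := fun h ↦
    hna ((dvd_reductionPointCount_iff_dvd_frobeniusTrace_sub_one W p).mp h)
  exact hSak3 W p h5 ⟨hgood, hord⟩ hsur hnap htam D hc hu hle ℓ hℓ P hP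

/-! ## §2 KERNEL BRIDGE: local `p`-indivisibility at `q` from an affine addition chain in `Ẽ(𝔽_q)` -/

section Bridge

variable (V : WeierstrassCurve ℤ) (q : ℕ) [Fact q.Prime]

/-- The two `ℚ_q`-models agree: `(V.map (ℤ → ℚ)).baseChange ℚ_q = (V.map (ℤ → ℤ_q)).baseChange ℚ_q`
(uniqueness of ring maps out of `ℤ`). [folklore] -/
theorem rat_padic_model_eq :
    (V.map (Int.castRingHom ℚ)).baseChange ℚ_[q] = (V.map (Int.castRingHom ℤ_[q])).baseChange ℚ_[q] := by
  rw [WeierstrassCurve.baseChange, WeierstrassCurve.baseChange, WeierstrassCurve.map_map, WeierstrassCurve.map_map]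
  exact congrArg V.map (RingHom.ext_int _ _)

/-- A rational affine point of `V/ℚ` gives the `ℚ_q`-point with the cast coordinates. [folklore] -/
theorem nonsingular_padic_of_rat {x y : ℚ} (h : (V.map (Int.castRingHom ℚ)).toAffine.Nonsingular x y) :
    ((V.map (Int.castRingHom ℚ)).baseChange ℚ_[q]).toAffine.Nonsingular (x : ℚ_[q]) (y : ℚ_[q]) := by
  have := (Affine.baseChange_nonsingular (W := (V.map (Int.castRingHom ℚ)).toAffine) (f := Algebra.ofId ℚ ℚ_[q])
    (Algebra.ofId ℚ ℚ_[q]).toRingHom.injective x y).mpr h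
  simpa only [eq_ratCast] using this

/-- `ι_q (x, y) = (↑x, ↑y)` for Mathlib's base change of points along `ℚ → ℚ_q` (as the tree's
`toPadicPoint_some`). [folklore] -/
theorem map_ofId_padic_some {x y : ℚ} (h : (V.map (Int.castRingHom ℚ)).toAffine.Nonsingular x y) :
    WeierstrassCurve.Affine.Point.map (W' := (V.map (Int.castRingHom ℚ)).toAffine) (S := ℚ) (Algebra.ofId ℚ ℚ_[q])
        (.some x y h) = .some (x : ℚ_[q]) (y : ℚ_[q]) (nonsingular_padic_of_rat V q h) := by
  refine (Affine.Point.map_some (W' := (V.map (Int.castRingHom ℚ)).toAffine) (Algebra.ofId ℚ ℚ_[q]) h).trans ?_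
  congr 1

/-- **The reduction homomorphism `E(ℚ) → Ẽ(𝔽_q)` factors through `E(ℚ_q)` on affine points** (by construction
of `Rank2Observatory.reduceMod`: `E(ℚ) → E(ℚ_q) → Ẽ(ℤ_q/q) → Ẽ(ZMod q)`): the reduction of a rational point
`(x, y)` is `ψ_q` of the `ℚ_q`-point `(↑x, ↑y)` of the `ℤ_q`-model, `ψ_q` = the tree's `goodReductionHom` over
`ℤ_q` followed by `residuePointHom`. [cite: SilvermanAEC2009, VII.2 Prop. 2.1] -/
theorem reduceMod_some_eq_psi (hq : ¬ (q : ℤ) ∣ V.Δ) {x y : ℚ}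
    (h : (V.map (Int.castRingHom ℚ)).toAffine.Nonsingular x y) :
    reduceMod V q hq (.some x y h) =
      (residuePointHom V q)
        (goodReductionHom (V.map (Int.castRingHom ℤ_[q])) (padicInt_valuationIntegers q)
          (isUnit_Δ_map_padicInt V q hq)
          (.some (x : ℚ_[q]) (y : ℚ_[q]) (rat_padic_model_eq V q ▸ nonsingular_padic_of_rat V q h))) := by
  change (residuePointHom V q) (goodReductionHom (V.map (Int.castRingHom ℤ_[q])) (padicInt_valuationIntegers q)
      (isUnit_Δ_map_padicInt V q hq)
      (Affine.Point.congrEquiv (padic_model_eq V q)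
        (Affine.Point.baseChange (W' := V) ℚ ℚ_[q] (Affine.Point.congrEquiv (rat_model_eq V) (.some x y h))))) = _
  rw [Affine.Point.congrEquiv_some, Affine.Point.baseChange, Affine.Point.map_some, Affine.Point.congrEquiv_some]
  congr 2

/-- **KERNEL BRIDGE: `P ∉ p·E(ℚ_q)` from an addition chain in `Ẽ(𝔽_q)`.** `V` an integral model, `q ∤ Δ(V)` a
prime, `P = (X, Y)` an integral point, `p·k = #Ẽ(𝔽_q)`, and a `decide`-checked affine addition chain
(`Rank2Observatory.chainB`) from `P̄ = (X̄, Ȳ)` reaching the multiplier `k` — so `k • P̄ ≠ O`. THEN `p • Q ≠ P`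
for every `Q ∈ E(ℚ_q)`: otherwise `k • P̄ = k • (p • Q̄) = #Ẽ(𝔽_q) • Q̄ = O` (reduction is a homomorphism on
`E(ℚ_q)`, AEC VII.2.1; Lagrange in `Ẽ(𝔽_q)`). Equivalently the image of `P` in `E(ℚ_q) ⊗ 𝔽_p ≅ Ẽ(𝔽_q) ⊗ 𝔽_p`
is non-zero. [cite: SilvermanAEC2009, VII.2 Prop. 2.1, VII.3 Prop. 3.1] -/
theorem localNondivisible_of_chainB (hq : ¬ (q : ℤ) ∣ V.Δ) {X Y : ℤ} (hXY : V.toAffine.Equation X Y)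
    (h : (V.map (Int.castRingHom ℚ)).toAffine.Nonsingular (X : ℚ) (Y : ℚ))
    {p k : ℕ} (hpk : p * k = Nat.card (V.map (Int.castRingHom (ZMod q))).toAffine.Point)
    {steps : List (Bool × ZMod q × ZMod q)} (hmult : chainMult 1 steps = k)
    (hc : chainB V q (X : ZMod q) (Y : ZMod q) ((X : ZMod q), (Y : ZMod q)) steps = true) :
    ∀ Q : ((V.map (Int.castRingHom ℚ)).baseChange ℚ_[q]).toAffine.Point,
      p • Q ≠ WeierstrassCurve.Affine.Point.map (W' := (V.map (Int.castRingHom ℚ)).toAffine) (S := ℚ)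
        (Algebra.ofId ℚ ℚ_[q]) (.some (X : ℚ) (Y : ℚ) h) := by
  intro Q hQ
  -- `k • P̄ ≠ O` from the chain
  have hne := nsmul_ne_zero_of_chainB V q (nonsingular_zmod_of_equation V q hq hXY) hc
  rw [hmult] at hne
  -- `p • Q = (↑X, ↑Y)` in `E(ℚ_q)`, transported to the `ℤ_q`-model
  have hQ' : p • Q = .some ((X : ℚ) : ℚ_[q]) ((Y : ℚ) : ℚ_[q]) (nonsingular_padic_of_rat V q h) :=
    hQ.trans (map_ofId_padic_some V q h)
  have h1 : p • Affine.Point.congrEquiv (rat_padic_model_eq V q) Q =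
      .some ((X : ℚ) : ℚ_[q]) ((Y : ℚ) : ℚ_[q]) (rat_padic_model_eq V q ▸ nonsingular_padic_of_rat V q h) := by
    rw [← map_nsmul, hQ', Affine.Point.congrEquiv_some]
  -- the reduction of `P` is `p •` (the reduction of `Q`)
  set ψ : ((V.map (Int.castRingHom ℤ_[q])).baseChange ℚ_[q]).toAffine.Point →+
      (V.map (Int.castRingHom (ZMod q))).toAffine.Point :=
    (residuePointHom V q).comp (goodReductionHom (V.map (Int.castRingHom ℤ_[q])) (padicInt_valuationIntegers q)
      (isUnit_Δ_map_padicInt V q hq)) with hψ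
  have h2 : reduceMod V q hq (.some (X : ℚ) (Y : ℚ) h) = p • ψ (Affine.Point.congrEquiv (rat_padic_model_eq V q) Q) := by
    rw [reduceMod_some_eq_psi, ← map_nsmul, h1, hψ, AddMonoidHom.coe_comp, Function.comp_apply]
  rw [reduceMod_some V q hq hXY h] at h2
  apply hne
  rw [h2, ← mul_nsmul', mul_comm, hpk]
  exact card_nsmul_eq_zero'

/-- **KERNEL BRIDGE, rational-point form: `P ∉ p·E(ℚ_q)` from an addition chain in `Ẽ(𝔽_q)`** — as
`localNondivisible_of_chainB` for a rational point `P = (x, y)` whose denominators are prime to `q`, reduced to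
`P̄ = (m̄, m̄')` with `m ≡ x`, `m' ≡ y (mod q)` (the tree's `reduceMod_some_rat`): a `decide`-checked chain from
`(m̄, m̄')` reaching `k` with `p·k = #Ẽ(𝔽_q)` gives `p • Q ≠ P` for every `Q ∈ E(ℚ_q)`.
[cite: SilvermanAEC2009, VII.2 Prop. 2.1, VII.3 Prop. 3.1] -/
theorem localNondivisible_of_chainB_rat (hq : ¬ (q : ℤ) ∣ V.Δ) {x y : ℚ}
    (h : (V.map (Int.castRingHom ℚ)).toAffine.Nonsingular x y) (hx : ¬ q ∣ x.den) (hy : ¬ q ∣ y.den)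
    {m m' : ℤ} (hm : (q : ℤ) ∣ x.num - m * x.den) (hm' : (q : ℤ) ∣ y.num - m' * y.den)
    {p k : ℕ} (hpk : p * k = Nat.card (V.map (Int.castRingHom (ZMod q))).toAffine.Point)
    {steps : List (Bool × ZMod q × ZMod q)} (hmult : chainMult 1 steps = k)
    (hc : chainB V q (m : ZMod q) (m' : ZMod q) ((m : ZMod q), (m' : ZMod q)) steps = true) :
    ∀ Q : ((V.map (Int.castRingHom ℚ)).baseChange ℚ_[q]).toAffine.Point,
      p • Q ≠ WeierstrassCurve.Affine.Point.map (W' := (V.map (Int.castRingHom ℚ)).toAffine) (S := ℚ)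
        (Algebra.ofId ℚ ℚ_[q]) (.some x y h) := by
  intro Q hQ
  obtain ⟨h', hred⟩ := reduceMod_some_rat V q hq h hx hy hm hm'
  -- `k • P̄ ≠ O` from the chain
  have hne := nsmul_ne_zero_of_chainB V q h' hc
  rw [hmult] at hne
  -- `p • Q = (↑x, ↑y)` in `E(ℚ_q)`, transported to the `ℤ_q`-model
  have hQ' : p • Q = .some (x : ℚ_[q]) (y : ℚ_[q]) (nonsingular_padic_of_rat V q h) :=
    hQ.trans (map_ofId_padic_some V q h)
  have h1 : p • Affine.Point.congrEquiv (rat_padic_model_eq V q) Q =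
      .some (x : ℚ_[q]) (y : ℚ_[q]) (rat_padic_model_eq V q ▸ nonsingular_padic_of_rat V q h) := by
    rw [← map_nsmul, hQ', Affine.Point.congrEquiv_some]
  set ψ : ((V.map (Int.castRingHom ℤ_[q])).baseChange ℚ_[q]).toAffine.Point →+
      (V.map (Int.castRingHom (ZMod q))).toAffine.Point :=
    (residuePointHom V q).comp (goodReductionHom (V.map (Int.castRingHom ℤ_[q])) (padicInt_valuationIntegers q)
      (isUnit_Δ_map_padicInt V q hq)) with hψ
  have h2 : reduceMod V q hq (.some x y h) = p • ψ (Affine.Point.congrEquiv (rat_padic_model_eq V q) Q) := by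
    rw [reduceMod_some_eq_psi, ← map_nsmul, h1, hψ, AddMonoidHom.coe_comp, Function.comp_apply]
  rw [hred] at h2
  apply hne
  rw [h2, ← mul_nsmul', mul_comm, hpk]
  exact card_nsmul_eq_zero'

end Bridge

/-! ## §3 The twist form used by the row sockets -/

/-- **THE DECISIVE PRIME (twist form): the row's bit forces a unit at every ★-prime of the twist model.** `W`
globally minimal elliptic, `p ≥ 5` good ordinary for `W` with `ρ̄_{W,p}` onto, `d ≠ 0`, `p ∤ d`; `T` ANY globally
minimal model of `E^{(d)}` (`C • T = W.quadraticTwist d`; good ordinary reduction and surjectivity of `T` at `p`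
DERIVED from `W`, v16), with `a_p(T) ≢ 1` and Kodaira–Néron for `T` at `p`; the twist Selmer bound
`#Sel_p(E^{(d)}/ℚ) ≤ p` (= the row's bit in the exact reading of g14/g22) transported along `C`; `ℓ` a cyclic
Kolyvagin prime of `(T, p)` and `P ∈ T(ℚ)` with `P ∉ p·T(ℚ_ℓ)` (kernel: §2). THEN the claim of a Kurihara record
of `T` at `(p, ℓ)` HOLDS: a unit `δ̃_ℓ(T)` for every admissible datum — so a computed ZERO at `ℓ` refutes the
bit. CONDITIONAL on `hSak3`; per `(W, p, d, ℓ)`; BSD is not proved by it.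
[cite: Sakamoto2022pSelmer, Lemma 4.4, Lemma 4.6 (1)] [cite: SilvermanAEC2009, X.5 Cor. 5.4] -/
theorem twistKuriharaClaim_prime_of_natCard_selmerGroup_le
    (hSak3 : Literature.NumberTheory.EllipticCurves.Sakamoto2022_kuriharaNumber_prime_ne_zero_of_localNondivisible)
    (W : WeierstrassCurve ℚ) [W.IsElliptic] [W.IsGloballyMinimal] (p : ℕ) [hp : Fact p.Prime] (h5 : 5 ≤ p)
    (hgood : W.HasGoodReductionAtPrime p) (hord : ¬ (p : ℤ) ∣ W.frobeniusTrace p)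
    (hsur : W.HasSurjectiveModNGaloisRep p) {d : ℤ} (hd : d ≠ 0) (hpd : ¬ (p : ℤ) ∣ d)
    (T : WeierstrassCurve ℚ) [T.IsElliptic] [T.IsGloballyMinimal] (C : VariableChange ℚ)
    (hC : C • T = W.quadraticTwist (d : ℚ))
    (hTna : ¬ (p : ℤ) ∣ T.frobeniusTrace p - 1)
    (hTKN : ∀ v : HeightOneSpectrum (𝓞 ℚ), T.HasMultiplicativeReductionAt v → ¬ p ∣ T.ordMinimalDiscriminant v)
    (hle : Nat.card ((W.quadraticTwist (d : ℚ)).selmerGroup p) ≤ p)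
    (ℓ : ℕ) [Fact ℓ.Prime] (hℓ : IsCyclicKolyvaginLevel T p ℓ)
    (P : T.toAffine.Point)
    (hP : ∀ Q : (T.baseChange ℚ_[ℓ]).toAffine.Point,
      p • Q ≠ WeierstrassCurve.Affine.Point.map (W' := T.toAffine) (S := ℚ) (Algebra.ofId ℚ ℚ_[ℓ]) P)
    {N : ℕ} [NeZero N] (D : ModularParametrizationData T N) (hc : ¬ (p : ℤ) ∣ D.maninConstant)
    (hu : ∃ u : ℚ, ‖(u : ℚ_[p])‖ = 1 ∧ T.realPeriodRat = u * plusPeriod D.f) :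
    ∃ ψ : (q : ℕ) → (ZMod q)ˣ →* Multiplicative (ZMod p),
      (∀ q ∈ ℓ.primeFactors, Function.Surjective (ψ q)) ∧ kuriharaNumber D.f p ℓ ψ ≠ 0 := by
  have hpP : p.Prime := hp.out
  have hdq : (d : ℚ) ≠ 0 := by exact_mod_cast hd
  have hTsur : T.HasSurjectiveModNGaloisRep p := hasSurjectiveModNGaloisRep_of_smul_eq_quadraticTwist W T hdq hC p hsur
  have hp2d : ¬ ((p : ℤ) ∣ 2 * d) := by
    intro h
    rcases (Nat.prime_iff_prime_int.mp hpP).dvd_or_dvd h with h2 | h2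
    · have : p = 2 := (Nat.prime_dvd_prime_iff_eq hpP Nat.prime_two).mp (by exact_mod_cast h2)
      omega
    · exact hpd h2
  obtain ⟨hTgood, hTord⟩ := goodOrdinary_of_smul_eq_quadraticTwist_of_ne_zero W T hd hC p hp2d hgood hord
  rw [← natCard_selmerGroup_eq_of_variableChange (p : ℤ) hC] at hle
  exact kuriharaClaim_prime_of_natCard_selmerGroup_le hSak3 T p h5 hTgood hTord hTsur hTna hTKN hle ℓ hℓ P hP D hc hu

end Summit.BirchSwinnertonDyer.BirchSwinnertonDyer.Theorems.KolyvaginDepthDoor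

end
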